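import Summits.CriticalPhenomena.SAWScalingLimit.Theorems.SAWReversalUpgradeFaithfulOfNoReturnAccess
import HarnessLib

/-!
# Route `SAWReversalUpgrade`, support `FaithfulOfNoReturn` (stmt-CriticalPhenomena-18008):
# the exit ray, the second cut time `vMid`, and `uMid < vMid`

Helper file (5 of several) for the proof of
`Summit.CriticalPhenomena.SAWScalingLimit.Theses.SAWReversalUpgrade.FaithfulOfNoReturn`,
in the vocabulary of `SAWReversalUpgradeAttachReversalDefs` (`qEx`, `rEx`, `vMid`).

The exit ray is `t ↦ Φ (t · q)`, `q = qEx b Φ e R = A_e (ψ (R j))`, `j = firstB b R`.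
Two regimes: if `R j ≠ b` then `j = 1`, `q ∈ ℍₒ`, the ray `t ≥ 1` is a simple arc in `D` tending to
`b`, `rEx ≥ 1` is its last parameter meeting the pushed middle arc `midSet`, and
`vMid = sup {u ∈ [i, j] | Z u = Φ (rEx · q)}`; if `R j = b` then `rEx = 1`, the ray is not used, and
`vMid = j` with `Z vMid = b`. In both regimes the polyline is `r₀/2`-close to `b` at `vMid`, hence
(no escape) `ε₀`-close to `b` on `[vMid, 1]`; with the no-deep-return control at `uMid` this gives
`uMid < vMid`, so a standard attachment has the prescribed trace `attSet`.
-/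

noncomputable section

open Set Filter Metric Complex Function
open scoped Topology
open UpperHalfPlane (upperHalfPlaneSet)
open Literature.Probability.RandomPlanarGeometry

namespace Summit.CriticalPhenomena.SAWScalingLimit.Theorems

namespace FaithfulAttach

open AttachReversal

variable {D : DobrushinDomain} {φ : ConformalEquiv upperHalfPlaneSet D.carrier} {e : ℝ} {R : ℝ → ℂ}
  (hφ : D.IsChordalUniformizing φ) (he0 : 0 < e) (he1 : e ≤ 1 / 2)
  (hRc : Continuous R) (hRmem : ∀ u, R u ∈ closure D.carrier) (hR1 : R 1 ∈ D.carrier)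
  (hij : lastA (D.pt 0) R ≤ firstB (D.pt 1) R)

/-- `qEx` unfolded. -/
theorem qEx_eq (b : ℂ) (Φ : ℂ → ℂ) (e : ℝ) (R : ℝ → ℂ) :
    qEx b Φ e R = squeeze e (hinv Φ (R (firstB b R))) := rfl

/-! ### The regime `R j ≠ b`: the exit ray is used -/

section RayUsed

variable (hjb : R (firstB (D.pt 1) R) ≠ D.pt 1)

include hRc hR1 hjb in
/-- In the regime `R j ≠ b`: `R j = R 1 ∈ D`. -/
theorem apply_firstB_mem_carrier : R (firstB (D.pt 1) R) ∈ D.carrier := by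
  rwa [firstB_eq_one_of_ne hRc hjb]

include hφ he0 he1 hRc hR1 hjb in
/-- In the regime `R j ≠ b`, the exit direction `q` lies in the open half-plane. -/
theorem im_qEx_pos : 0 < (qEx (D.pt 1) φ.boundaryExtension e R).im := by
  have hw := hinv_im_pos hφ (apply_firstB_mem_carrier hRc hR1 hjb)
  refine sqz_im_pos he0 he1 (squeeze_spec e) hw.le fun h0 => ?_
  rw [h0, zero_im] at hw
  exact lt_irrefl _ hw

include hRc hjb in
/-- In the regime `R j ≠ b`: `‖q‖ = ‖ψ (R 1)‖`. -/
theorem norm_qEx : ‖qEx (D.pt 1) φ.boundaryExtension e R‖ = ‖hinv φ.boundaryExtension (R 1)‖ := by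
  rw [qEx_eq, sqz_norm (squeeze_spec e), firstB_eq_one_of_ne hRc hjb]

include hφ he0 he1 hRc hRmem hR1 hij hjb in
/-- **The exit-ray facts (regime `R j ≠ b`).** With `q = qEx`, `r = rEx`, `M = midSet`,
`β t = Φ (t · q)`: `1 ≤ r`; `β r ∈ M`; `β t ∉ M` for `t > r`. -/
theorem rEx_facts :
    1 ≤ rEx (D.pt 0) (D.pt 1) φ.boundaryExtension e R ∧
    φ.boundaryExtension ((rEx (D.pt 0) (D.pt 1) φ.boundaryExtension e R : ℂ) *
      qEx (D.pt 1) φ.boundaryExtension e R) ∈ midSet (D.pt 0) (D.pt 1) φ.boundaryExtension e R ∧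
    ∀ t : ℝ, rEx (D.pt 0) (D.pt 1) φ.boundaryExtension e R < t →
      φ.boundaryExtension ((t : ℂ) * qEx (D.pt 1) φ.boundaryExtension e R) ∉
        midSet (D.pt 0) (D.pt 1) φ.boundaryExtension e R := by
  set q := qEx (D.pt 1) φ.boundaryExtension e R with hq
  set M := midSet (D.pt 0) (D.pt 1) φ.boundaryExtension e R with hM
  have hMc : IsClosed M := isClosed_midSet hφ he0 he1 hRc hRmem
  have hw : 0 < q.im := im_qEx_pos hφ he0 he1 hRc hR1 hjb
  have hq0 : 0 < ‖q‖ := norm_pos_iff.2 fun h => by rw [h, zero_im] at hw; exact lt_irrefl _ hw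
  set S : Set ℝ := {t : ℝ | 1 ≤ t ∧ R (firstB (D.pt 1) R) ≠ D.pt 1 ∧
    φ.boundaryExtension ((t : ℂ) * q) ∈ M} with hS
  have hS_eq : S = Ici 1 ∩ (fun t : ℝ => φ.boundaryExtension ((t : ℂ) * q)) ⁻¹' M := by
    ext t
    exact ⟨fun h => ⟨h.1, h.2.2⟩, fun h => ⟨h.1, hjb, h.2⟩⟩
  have hSc : IsClosed S := by
    rw [hS_eq]
    exact ((continuousOn_ray hw).mono (Ici_subset_Ici.2 zero_le_one)).preimage_isClosed_of_isClosed
      isClosed_Ici hMc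
  have h1S : (1:ℝ) ∈ S := by
    refine ⟨le_rfl, hjb, ⟨firstB (D.pt 1) R, ⟨hij, le_rfl⟩, ?_⟩⟩
    rw [attZ_apply, if_neg hjb, ofReal_one, one_mul, hq, qEx_eq]
  -- `b ∉ M`, so the ray leaves `M` for large parameters: `S` is bounded above
  have hbM : D.pt 1 ∉ M := fun h => hjb (apply_firstB_eq_of_pt_one_mem_midSet hφ he0 he1 hRc hRmem h)
  obtain ⟨ρ, hρ, hball⟩ := Metric.isOpen_iff.1 hMc.isOpen_compl (D.pt 1) hbM
  obtain ⟨Mfar, -, hfar⟩ := exists_norm_le_dist_bext_lt hφ hρ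
  have hSbdd : BddAbove S := by
    refine ⟨Mfar / ‖q‖, fun t ht => ?_⟩
    by_contra hlt
    rw [not_le] at hlt
    have ht0 : 0 ≤ t := zero_le_one.trans ht.1
    have hnorm : Mfar ≤ ‖(t : ℂ) * q‖ := by
      rw [norm_ray t ht0]
      rw [div_lt_iff₀ hq0] at hlt
      exact hlt.le
    exact hball (mem_ball.2 (hfar _ (ray_im_nonneg hw.le ht0) hnorm)) ht.2.2
  have hunion : ({(1:ℝ)} ∪ S) = S := union_eq_right.2 (singleton_subset_iff.2 h1S)
  have hr_def : rEx (D.pt 0) (D.pt 1) φ.boundaryExtension e R = sSup S := by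
    rw [← hunion]
    rfl
  have hrS : rEx (D.pt 0) (D.pt 1) φ.boundaryExtension e R ∈ S := hr_def ▸ hSc.csSup_mem ⟨1, h1S⟩ hSbdd
  refine ⟨hrS.1, hrS.2.2, fun t ht htM => ?_⟩
  have htS : t ∈ S := ⟨hrS.1.trans ht.le, hjb, htM⟩
  exact (le_csSup hSbdd htS).not_gt (hr_def ▸ ht)

include hφ he0 he1 hRc hRmem hR1 hij hjb in
/-- **The cut time `vMid` (regime `R j ≠ b`)**: `vMid ∈ [i, j]`, `Z vMid = Φ (rEx · q)`, and no later
time of `(vMid, j]` is sent there by `Z`. -/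
theorem vMid_facts_of_ne :
    vMid (D.pt 0) (D.pt 1) φ.boundaryExtension e R ∈ Icc (lastA (D.pt 0) R) (firstB (D.pt 1) R) ∧
    attZ (D.pt 1) φ.boundaryExtension e R (vMid (D.pt 0) (D.pt 1) φ.boundaryExtension e R) =
      φ.boundaryExtension ((rEx (D.pt 0) (D.pt 1) φ.boundaryExtension e R : ℂ) *
        qEx (D.pt 1) φ.boundaryExtension e R) ∧
    ∀ u' ∈ Ioc (vMid (D.pt 0) (D.pt 1) φ.boundaryExtension e R) (firstB (D.pt 1) R),
      attZ (D.pt 1) φ.boundaryExtension e R u' ≠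
        φ.boundaryExtension ((rEx (D.pt 0) (D.pt 1) φ.boundaryExtension e R : ℂ) *
          qEx (D.pt 1) φ.boundaryExtension e R) := by
  set x := φ.boundaryExtension ((rEx (D.pt 0) (D.pt 1) φ.boundaryExtension e R : ℂ) *
    qEx (D.pt 1) φ.boundaryExtension e R) with hx
  set V : Set ℝ := {u : ℝ | u ∈ Icc (lastA (D.pt 0) R) (firstB (D.pt 1) R) ∧
    attZ (D.pt 1) φ.boundaryExtension e R u = x} with hV
  have hV_eq : ({u : ℝ | u ∈ Icc (lastA (D.pt 0) R) (firstB (D.pt 1) R) ∧ R (firstB (D.pt 1) R) = D.pt 1 ∧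
      u = firstB (D.pt 1) R} ∪ {u : ℝ | u ∈ Icc (lastA (D.pt 0) R) (firstB (D.pt 1) R) ∧
      R (firstB (D.pt 1) R) ≠ D.pt 1 ∧ attZ (D.pt 1) φ.boundaryExtension e R u = x}) = V := by
    ext u
    simp only [mem_union, mem_setOf_eq, hV]
    constructor
    · rintro (⟨-, h, -⟩ | ⟨h1, -, h3⟩)
      · exact absurd h hjb
      · exact ⟨h1, h3⟩
    · rintro ⟨h1, h3⟩
      exact Or.inr ⟨h1, hjb, h3⟩
  have hv_def : vMid (D.pt 0) (D.pt 1) φ.boundaryExtension e R = sSup V := by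
    rw [← hV_eq]
    rfl
  obtain ⟨u₀, hu₀, hu₀x⟩ := (rEx_facts hφ he0 he1 hRc hRmem hR1 hij hjb).2.1
  have hVne : V.Nonempty := ⟨u₀, hu₀, hu₀x⟩
  have hZc : Continuous (attZ (D.pt 1) φ.boundaryExtension e R) :=
    (continuousOn_transport' hφ he0 he1).comp_continuous hRc hRmem
  have hVc : IsClosed V := isClosed_Icc.inter (isClosed_singleton.preimage hZc)
  have hVbdd : BddAbove V := ⟨firstB (D.pt 1) R, fun t ht => ht.1.2⟩
  have hvV : vMid (D.pt 0) (D.pt 1) φ.boundaryExtension e R ∈ V := hv_def ▸ hVc.csSup_mem hVne hVbdd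
  refine ⟨hvV.1, hvV.2, fun u' hu' h => ?_⟩
  have hu'V : u' ∈ V := ⟨⟨hvV.1.1.trans hu'.1.le, hu'.2⟩, h⟩
  exact (le_csSup hVbdd hu'V).not_gt (hv_def ▸ hu'.1)

include hφ he0 he1 hRc hRmem hR1 hij hjb in
/-- In the regime `R j ≠ b`, `Z vMid` is `r₀/4`-close to `b` (the exit ray beyond parameter `1` lies in
`B(b, r₀/4)`). -/
theorem dist_attZ_vMid_lt_of_ne {r₀ : ℝ}
    (hex : ∀ z : ℂ, 0 ≤ z.im → ‖hinv φ.boundaryExtension (R 1)‖ ≤ ‖z‖ →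
      dist (φ.boundaryExtension z) (D.pt 1) < r₀ / 4) :
    dist (attZ (D.pt 1) φ.boundaryExtension e R (vMid (D.pt 0) (D.pt 1) φ.boundaryExtension e R))
      (D.pt 1) < r₀ / 4 := by
  obtain ⟨-, hZv, -⟩ := vMid_facts_of_ne hφ he0 he1 hRc hRmem hR1 hij hjb
  obtain ⟨hr1, -, -⟩ := rEx_facts hφ he0 he1 hRc hRmem hR1 hij hjb
  have hw := im_qEx_pos hφ he0 he1 hRc hR1 hjb
  rw [hZv]
  refine hex _ (ray_im_nonneg hw.le (zero_le_one.trans hr1)) ?_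
  rw [norm_ray _ (zero_le_one.trans hr1), ← norm_qEx hRc hjb]
  exact le_mul_of_one_le_left (norm_nonneg _) hr1

end RayUsed

/-! ### The regime `R j = b`: the polyline hits `b`, the exit ray is not used -/

section RayUnused

variable (hjb : R (firstB (D.pt 1) R) = D.pt 1)

include hjb in
/-- In the regime `R j = b`: `rEx = 1`. -/
theorem rEx_eq_one_of_eq : rEx (D.pt 0) (D.pt 1) φ.boundaryExtension e R = 1 := by
  have : ({(1:ℝ)} ∪ {r : ℝ | 1 ≤ r ∧ R (firstB (D.pt 1) R) ≠ D.pt 1 ∧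
      φ.boundaryExtension ((r : ℂ) * qEx (D.pt 1) φ.boundaryExtension e R) ∈
        midSet (D.pt 0) (D.pt 1) φ.boundaryExtension e R}) = {1} := by
    refine union_eq_left.2 ?_
    rintro t ⟨-, h, -⟩
    exact absurd hjb h
  rw [rEx, this, csSup_singleton]

include hij hjb in
/-- In the regime `R j = b`: `vMid = j`. -/
theorem vMid_eq_firstB_of_eq : vMid (D.pt 0) (D.pt 1) φ.boundaryExtension e R = firstB (D.pt 1) R := by
  have : ({u : ℝ | u ∈ Icc (lastA (D.pt 0) R) (firstB (D.pt 1) R) ∧ R (firstB (D.pt 1) R) = D.pt 1 ∧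
      u = firstB (D.pt 1) R} ∪ {u : ℝ | u ∈ Icc (lastA (D.pt 0) R) (firstB (D.pt 1) R) ∧
      R (firstB (D.pt 1) R) ≠ D.pt 1 ∧ attZ (D.pt 1) φ.boundaryExtension e R u =
        φ.boundaryExtension ((rEx (D.pt 0) (D.pt 1) φ.boundaryExtension e R : ℂ) *
          qEx (D.pt 1) φ.boundaryExtension e R)}) = {firstB (D.pt 1) R} := by
    ext u
    simp only [mem_union, mem_setOf_eq, mem_singleton_iff]
    constructor
    · rintro (⟨-, -, h⟩ | ⟨-, h, -⟩)
      · exact h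
      · exact absurd hjb h
    · rintro rfl
      exact Or.inl ⟨⟨hij, le_rfl⟩, hjb, rfl⟩
  rw [vMid, this, csSup_singleton]

include hφ he0 he1 hRmem hij hjb in
/-- In the regime `R j = b`: `Z vMid = b`. -/
theorem attZ_vMid_of_eq :
    attZ (D.pt 1) φ.boundaryExtension e R (vMid (D.pt 0) (D.pt 1) φ.boundaryExtension e R) = D.pt 1 := by
  rw [vMid_eq_firstB_of_eq hij hjb]
  exact (transport'_eq_pt_one_iff hφ he0 he1 (hRmem _)).2 hjb

end RayUnused

/-! ### Both regimes: position of `vMid`, no escape after it, and `uMid < vMid` -/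

include hφ he0 he1 hRc hRmem hR1 hij in
/-- `vMid ∈ [i, j]`. -/
theorem vMid_mem_Icc :
    vMid (D.pt 0) (D.pt 1) φ.boundaryExtension e R ∈ Icc (lastA (D.pt 0) R) (firstB (D.pt 1) R) := by
  by_cases hjb : R (firstB (D.pt 1) R) = D.pt 1
  · rw [vMid_eq_firstB_of_eq hij hjb]
    exact ⟨hij, le_rfl⟩
  · exact (vMid_facts_of_ne hφ he0 he1 hRc hRmem hR1 hij hjb).1

include hφ he0 he1 hRc hRmem hR1 hij in
/-- At the second cut time the polyline is `r₀/2`-close to `b`. -/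
theorem dist_apply_vMid_lt {r₀ κ : ℝ} (hκ : 0 < κ) (hκr : κ ≤ r₀ / 4)
    (hclose : ∀ z : ℂ, 0 ≤ z.im → dist (φ.boundaryExtension (squeeze e z)) (φ.boundaryExtension z) < κ)
    (hex : ∀ z : ℂ, 0 ≤ z.im → ‖hinv φ.boundaryExtension (R 1)‖ ≤ ‖z‖ →
      dist (φ.boundaryExtension z) (D.pt 1) < r₀ / 4) :
    dist (R (vMid (D.pt 0) (D.pt 1) φ.boundaryExtension e R)) (D.pt 1) < r₀ / 2 := by
  have hr₀ : 0 < r₀ := by linarith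
  by_cases hjb : R (firstB (D.pt 1) R) = D.pt 1
  · rw [vMid_eq_firstB_of_eq hij hjb, hjb, dist_self]
    positivity
  · have h1 : dist (attZ (D.pt 1) φ.boundaryExtension e R (vMid (D.pt 0) (D.pt 1) φ.boundaryExtension e R))
        (R (vMid (D.pt 0) (D.pt 1) φ.boundaryExtension e R)) < κ :=
      dist_transport'_lt hφ hκ hclose (hRmem _)
    have h2 := dist_attZ_vMid_lt_of_ne hφ he0 he1 hRc hRmem hR1 hij hjb hex
    rw [dist_comm] at h1
    linarith [dist_triangle (R (vMid (D.pt 0) (D.pt 1) φ.boundaryExtension e R))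
      (attZ (D.pt 1) φ.boundaryExtension e R (vMid (D.pt 0) (D.pt 1) φ.boundaryExtension e R)) (D.pt 1)]

include hφ he0 he1 hRc hRmem hR1 hij in
/-- **No escape after the second cut**: the polyline is `ε₀`-close to `b` on `[vMid, 1]`. -/
theorem dist_lt_of_vMid_le {ε₀ r₀ κ : ℝ} (hrε : r₀ < ε₀) (hκ : 0 < κ) (hκr : κ ≤ r₀ / 4)
    (hclose : ∀ z : ℂ, 0 ≤ z.im → dist (φ.boundaryExtension (squeeze e z)) (φ.boundaryExtension z) < κ)
    (hex : ∀ z : ℂ, 0 ≤ z.im → ‖hinv φ.boundaryExtension (R 1)‖ ≤ ‖z‖ →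
      dist (φ.boundaryExtension z) (D.pt 1) < r₀ / 4)
    (hNE : ∀ s t : ℝ, 0 ≤ t → t < s → s ≤ 1 → dist (R t) (D.pt 1) ≤ r₀ →
      ε₀ ≤ dist (R s) (D.pt 1) → False)
    {t : ℝ} (ht : vMid (D.pt 0) (D.pt 1) φ.boundaryExtension e R ≤ t) (ht1 : t ≤ 1) :
    dist (R t) (D.pt 1) < ε₀ := by
  have hv := dist_apply_vMid_lt hφ he0 he1 hRc hRmem hR1 hij hκ hκr hclose hex
  have hv0 : 0 ≤ vMid (D.pt 0) (D.pt 1) φ.boundaryExtension e R :=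
    (lastA_mem_Icc' hRc (D.pt 0)).1.trans (vMid_mem_Icc hφ he0 he1 hRc hRmem hR1 hij).1
  have hr₀ : 0 < r₀ := by linarith
  rcases ht.lt_or_eq with hlt | heq
  · by_contra hge
    rw [not_lt] at hge
    exact hNE t _ hv0 hlt ht1 (by linarith) hge
  · rw [← heq]
    linarith

include hφ he0 he1 hRc hRmem hR1 hij in
/-- **`uMid < vMid` on the good event**: the polyline is `r₀/2`-close to `a` at `uMid` and stays
`ε₀`-close to `b` after `vMid`, while `a`, `b` are `2ε₀` apart. -/
theorem uMid_lt_vMid {ε₀ r₀ κ : ℝ} (hrε : r₀ < ε₀) (hab : 2 * ε₀ ≤ dist (D.pt 0) (D.pt 1))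
    (hκ : 0 < κ) (hκr : κ ≤ r₀ / 4) (hR0 : R 0 ∈ D.carrier)
    (hclose : ∀ z : ℂ, 0 ≤ z.im → dist (φ.boundaryExtension (squeeze e z)) (φ.boundaryExtension z) < κ)
    (hacc : ∀ z : ℂ, 0 ≤ z.im → ‖z‖ ≤ ‖hinv φ.boundaryExtension (R 0)‖ →
      dist (φ.boundaryExtension z) (D.pt 0) < r₀ / 4)
    (hex : ∀ z : ℂ, 0 ≤ z.im → ‖hinv φ.boundaryExtension (R 1)‖ ≤ ‖z‖ →
      dist (φ.boundaryExtension z) (D.pt 1) < r₀ / 4)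
    (hNE : ∀ s t : ℝ, 0 ≤ t → t < s → s ≤ 1 → dist (R t) (D.pt 1) ≤ r₀ →
      ε₀ ≤ dist (R s) (D.pt 1) → False) :
    uMid (D.pt 0) (D.pt 1) φ.boundaryExtension e R < vMid (D.pt 0) (D.pt 1) φ.boundaryExtension e R := by
  by_contra h
  rw [not_lt] at h
  have hu := dist_apply_uMid_lt hφ he0 he1 hRc hRmem hR0 hij hκ hκr hclose hacc
  have hu1 : uMid (D.pt 0) (D.pt 1) φ.boundaryExtension e R ≤ 1 :=
    (uMid_facts hφ he0 he1 hRc hRmem hR0 hij).1.2.trans (firstB_mem_Icc' hRc (D.pt 1)).2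
  have hb := dist_lt_of_vMid_le hφ he0 he1 hRc hRmem hR1 hij hrε hκ hκr hclose hex hNE h hu1
  exact not_close_both hab (by linarith) hb

end FaithfulAttach

end Summit.CriticalPhenomena.SAWScalingLimit.Theorems
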